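import Mathlib
import HarnessLib
import Summits.Ventures.LatticeQCDFlow.Exactness.SUNJitteredHMCCertificates
import Summits.Ventures.LatticeQCDFlow.Exactness.NCMCGeneralSpaceDoeblinPower
import Summits.Ventures.LatticeQCDFlow.Scoring.DoeblinPowerBatchMeans

/-!
# What the certificates of the engine's jittered `SU(N)` HMC buy for the cell's figures of merit: every event a finite `τ_int` (one constant for all events), geometric decorrelation, a finite asymptotic variance for every bounded observable, a certified burn-in `B/n` from every start — alone or followed by ANY exact step

HONEST FRAMING: exact (Metropolis-corrected) sampling algorithms for lattice gauge theory;
figures of merit are autocorrelation/cost numbers at stated couplings and volumes; no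
continuum-physics claim.

Venture `LatticeQCDFlow` (cell pub-lqcd), topic `Exactness`, FANOUT row 9 (eng-latcore, GEN-23; the engine
`latflow.core.hmc.HMC(f, β, 'leapfrog').trajectory(τ, nstep, tau_jitter = j)` and `updates.composite_sweep(f, β,
'hmc', n_or)`).  NEW WORK of the cell over the tree, nothing cited as a fact, no number claimed:
`SUNJitteredHMCCertificates.lean` (GEN-23: the named kernel `wilsonJitterHMC`, `wilsonJitterHMC_invariant`,
`wilsonJitterHMC_certificate`, `wilsonJitterHMC_exactStep_certificate`), row 13's `NCMCGeneralSpaceDoeblinPower.lean`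
(`tauInt_setACF_le_of_nHit`, `abs_setAutocov_le_of_nHit`, `chain_timeAverage_bias_le_of_nHit`, `minorised_setwise`) and
row 8's `Scoring/DoeblinPowerBatchMeans.lean` (`greenKubo_nonneg_of_nHit`, `greenKubo_le_of_nHit`).  Printed
counterparts NAMED ONLY: Meyn–Tweedie 1993 ch. 16; Sokal 1997 §2 (`τ_int`, `σ²_f = 2 τ_int,f Var f`).

The cell's FIGURES OF MERIT are `τ_int` of sector indicators and bounded observables and the error bars /
burn-in of time averages.  For the engine's jittered `SU(N)` HMC AS RUN (torus `(ℤ/L)^d`, any real `β`, the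
engine's momenta, Wilson force law and Metropolis test; ANY `nstep`, ANY length assignment `τ`, ANY jitter law `η`
with ONE short atom `l₀`), this file turns GEN-23's certificates into exactly those statements, value-free.

## Content (`π = wilsonMeasure (β/N)`; every theorem: `∃ τ₀ > 0` on `N, d, L, β` only, then for EVERY `nstep`, `τ`,
## `η`, `l₀` with `η{l₀} ≠ 0`, `nstep l₀ ≥ 1`, `0 < τ l₀ ≤ τ₀`)

* §1 IN EQUILIBRIUM: **`wilsonJitterHMC_tauInt_setACF_le`** — ONE `B ≥ 0` with `τ_int(1_A) ≤ 1/2 + B/(1 − π(A))`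
  for EVERY measurable `A` with `0 < π(A) < 1` (scorers' `Scoring.tauInt`; a topological sector, a plaquette bin);
  **`wilsonJitterHMC_abs_setAutocov_le`** — `|C_t(A, B)| ≤ π(A) r^{⌊t/m⌋}` with ONE `r ∈ [0, 1)`, ONE `m > 0`;
  **`wilsonJitterHMC_greenKubo_le`** — `0 ≤ σ²_f ≤ V · C²` for EVERY measurable `f` with `|f| ≤ C`, ONE `V ≥ 0`
  (`σ²_f` = the Green–Kubo variance of `√n`-scaled time averages); **`wilsonJitterHMC_exactStep_tauInt_setACF_le`**
  (the composite with ANY `π`-invariant Markov step, e.g. `'hmc' + n_or × 'or'`).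
* §2 FROM EVERY START: **`wilsonJitterHMC_timeAverage_bias_le`** — ONE `B ≥ 0` with
  `|E_{μ₀}[(1/n) Σ_{t<n} g(U_t)] − π g| ≤ B/n` for EVERY initial law `μ₀`, every `[0,1]`-valued measurable `g`,
  every `n ≥ 1` (certified burn-in); **`wilsonJitterHMC_exactStep_timeAverage_bias_le`** (with ANY exact step).

NOT CLAIMED: any value of `τ₀, B, r, m, V` (compactness constants — astronomically weak; the MEASURED `τ_int(Q)`
stays the figure of merit); atomless jitter laws; every atom long; OMF words; floating point; unbounded
observables; the CLT / batch-means statements (`SUNJitteredHMCErrorBars.lean`).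
-/

noncomputable section

namespace Summit.Ventures.LatticeQCDFlow.Exactness

open MeasureTheory ProbabilityTheory ProbabilityTheory.Kernel Set Function Filter Topology
open Literature.MathematicalPhysics.QuantumFieldTheory
open Literature.MathematicalPhysics.QuantumLattice (fundamentalRep continuous_fundamentalRep)
open scoped ENNReal Matrix Matrix.Norms.Operator NNReal

set_option backward.isDefEq.respectTransparency false

section FiguresOfMerit

variable {N d L : ℕ} [NeZero N] [NeZero L] (β : ℝ)
variable {Lab : Type*} [Countable Lab] [MeasurableSpace Lab] [MeasurableSingletonClass Lab]

/-! ## §1 In equilibrium: every event has a finite `τ_int`, every bounded observable a finite `σ²_f` -/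

/-- The constant `m/ε' − 1` of a certificate is nonnegative. -/
theorem doeblinConst_nonneg {m : ℕ} {ε' : ℝ≥0∞} (hm : 0 < m) (hε0 : 0 < ε') (hε1 : ε' ≤ 1) :
    0 ≤ (m : ℝ) / ε'.toReal - 1 := by
  have he0 : 0 < ε'.toReal := ENNReal.toReal_pos hε0.ne' (ne_top_of_le_ne_top ENNReal.one_ne_top hε1)
  have he1 : ε'.toReal ≤ 1 := ENNReal.toReal_le_of_le_ofReal zero_le_one (by simpa using hε1)
  have hm1 : (1 : ℝ) ≤ m := by exact_mod_cast hm
  rw [sub_nonneg, le_div_iff₀ he0]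
  nlinarith

/-- **EVERY EVENT HAS A FINITE INTEGRATED AUTOCORRELATION TIME UNDER THE ENGINE'S JITTERED `SU(N)` HMC AS RUN
— ONE CONSTANT FOR ALL EVENTS** (scorers' `τ_int = 1/2 + Σ_{t≥1} ρ(t)`; `π = wilsonMeasure (β/N)`).  There is
`τ₀ > 0` (on `N, d, L, β` only) such that for EVERY `nstep`, `τ`, `η` and atom `l₀` (`η{l₀} ≠ 0`, `nstep l₀ ≥ 1`,
`0 < τ l₀ ≤ τ₀`) there is `B ≥ 0` with `τ_int(1_A) ≤ 1/2 + B/(1 − π(A))` for EVERY measurable `A` with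
`0 < π(A) < 1` — a topological sector, a plaquette bin, any event of the stationary chain. -/
theorem wilsonJitterHMC_tauInt_setACF_le :
    ∃ τ₀ : ℝ, 0 < τ₀ ∧ ∀ (nstep : Lab → ℕ) (τ : Lab → ℝ) (η : Measure Lab) [IsProbabilityMeasure η] (l₀ : Lab),
      1 ≤ nstep l₀ → η {l₀} ≠ 0 → 0 < τ l₀ → τ l₀ ≤ τ₀ →
      ∃ B : ℝ, 0 ≤ B ∧ ∀ A : Set (GaugeConfig d L (Matrix.specialUnitaryGroup (Fin N) ℂ)), MeasurableSet A →
        0 < (wilsonMeasure (d := d) (L := L) (fundamentalRep (Fin N)) (β / N)).real A →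
        (wilsonMeasure (d := d) (L := L) (fundamentalRep (Fin N)) (β / N)).real A < 1 →
        Scoring.tauInt (setACF (wilsonJitterHMC N d L β nstep τ η)
            (wilsonMeasure (d := d) (L := L) (fundamentalRep (Fin N)) (β / N)) A) ≤
          1 / 2 + B / (1 - (wilsonMeasure (d := d) (L := L) (fundamentalRep (Fin N)) (β / N)).real A) := by
  obtain ⟨τ₀, hτ₀, h⟩ := wilsonJitterHMC_certificate (N := N) (d := d) (L := L) (Lab := Lab) β
  refine ⟨τ₀, hτ₀, fun nstep τ η _ l₀ hn hl₀ hτl hτl₀ => ?_⟩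
  obtain ⟨m, ε', hm, hε0, hε1, hmin⟩ := h nstep τ η l₀ hn hl₀ hτl hτl₀
  refine ⟨(m : ℝ) / ε'.toReal - 1, doeblinConst_nonneg hm hε0 hε1, fun A hA h0 h1 => ?_⟩
  exact GeneralNCMC.tauInt_setACF_le_of_nHit (GeneralNCMC.minorised_setwise hmin) hε0 hε1 hm
    (wilsonJitterHMC_invariant (N := N) (d := d) (L := L) β nstep τ η) hA h0 h1

/-- **GEOMETRIC DECORRELATION OF EVENTS IN EQUILIBRIUM**: same `τ₀` and hypotheses; there are `m > 0` and
`r ∈ [0, 1)` with `|C_t(A, B)| = |π(U_0 ∈ A, U_t ∈ B) − π(A)π(B)| ≤ π(A) · r^{⌊t/m⌋}` for EVERY measurable `A, B`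
and every `t`. -/
theorem wilsonJitterHMC_abs_setAutocov_le :
    ∃ τ₀ : ℝ, 0 < τ₀ ∧ ∀ (nstep : Lab → ℕ) (τ : Lab → ℝ) (η : Measure Lab) [IsProbabilityMeasure η] (l₀ : Lab),
      1 ≤ nstep l₀ → η {l₀} ≠ 0 → 0 < τ l₀ → τ l₀ ≤ τ₀ →
      ∃ m : ℕ, ∃ r : ℝ, 0 < m ∧ 0 ≤ r ∧ r < 1 ∧
        ∀ (t : ℕ) (A B : Set (GaugeConfig d L (Matrix.specialUnitaryGroup (Fin N) ℂ))), MeasurableSet A → MeasurableSet B →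
        |setAutocov (wilsonJitterHMC N d L β nstep τ η) (wilsonMeasure (d := d) (L := L) (fundamentalRep (Fin N)) (β / N)) t A B|
          ≤ (wilsonMeasure (d := d) (L := L) (fundamentalRep (Fin N)) (β / N)).real A * r ^ (t / m) := by
  obtain ⟨τ₀, hτ₀, h⟩ := wilsonJitterHMC_certificate (N := N) (d := d) (L := L) (Lab := Lab) β
  refine ⟨τ₀, hτ₀, fun nstep τ η _ l₀ hn hl₀ hτl hτl₀ => ?_⟩
  obtain ⟨m, ε', hm, hε0, hε1, hmin⟩ := h nstep τ η l₀ hn hl₀ hτl hτl₀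
  have he0 : 0 < ε'.toReal := ENNReal.toReal_pos hε0.ne' (ne_top_of_le_ne_top ENNReal.one_ne_top hε1)
  have he1 : ε'.toReal ≤ 1 := ENNReal.toReal_le_of_le_ofReal zero_le_one (by simpa using hε1)
  refine ⟨m, 1 - ε'.toReal, hm, sub_nonneg.2 he1, sub_lt_self _ he0, fun t A B hA hB => ?_⟩
  exact GeneralNCMC.abs_setAutocov_le_of_nHit (GeneralNCMC.minorised_setwise hmin) hε1
    (wilsonJitterHMC_invariant (N := N) (d := d) (L := L) β nstep τ η) t hA hB

/-- **EVERY BOUNDED OBSERVABLE HAS A FINITE, NONNEGATIVE ASYMPTOTIC VARIANCE — ONE CONSTANT FOR ALL**: same `τ₀`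
and hypotheses; there is `V ≥ 0` with `0 ≤ σ²_f ≤ V · C²` for EVERY measurable `f` with `|f| ≤ C`, where
`σ²_f = ∫ (f − πf)² dπ + 2 Σ_{k≥0} ∫ (f − πf) · K^{k+1}(f − πf) dπ` is the variance of `√n`-scaled time averages
(the Green–Kubo / `2 τ_int,f Var_π f` constant the scorers' error bars estimate). -/
theorem wilsonJitterHMC_greenKubo_le :
    ∃ τ₀ : ℝ, 0 < τ₀ ∧ ∀ (nstep : Lab → ℕ) (τ : Lab → ℝ) (η : Measure Lab) [IsProbabilityMeasure η] (l₀ : Lab),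
      1 ≤ nstep l₀ → η {l₀} ≠ 0 → 0 < τ l₀ → τ l₀ ≤ τ₀ →
      ∃ V : ℝ, 0 ≤ V ∧ ∀ (f : GaugeConfig d L (Matrix.specialUnitaryGroup (Fin N) ℂ) → ℝ), Measurable f →
        ∀ C : ℝ, (∀ U, |f U| ≤ C) →
        0 ≤ (∫ y, (f y - ∫ z, f z ∂(wilsonMeasure (d := d) (L := L) (fundamentalRep (Fin N)) (β / N))) ^ 2
              ∂(wilsonMeasure (d := d) (L := L) (fundamentalRep (Fin N)) (β / N)))
            + 2 * ∑' k, ∫ y, (f y - ∫ z, f z ∂(wilsonMeasure (d := d) (L := L) (fundamentalRep (Fin N)) (β / N)))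
              * (Scoring.kop (wilsonJitterHMC N d L β nstep τ η))^[k + 1]
                (fun y => f y - ∫ z, f z ∂(wilsonMeasure (d := d) (L := L) (fundamentalRep (Fin N)) (β / N))) y
              ∂(wilsonMeasure (d := d) (L := L) (fundamentalRep (Fin N)) (β / N)) ∧
        (∫ y, (f y - ∫ z, f z ∂(wilsonMeasure (d := d) (L := L) (fundamentalRep (Fin N)) (β / N))) ^ 2
              ∂(wilsonMeasure (d := d) (L := L) (fundamentalRep (Fin N)) (β / N)))
            + 2 * ∑' k, ∫ y, (f y - ∫ z, f z ∂(wilsonMeasure (d := d) (L := L) (fundamentalRep (Fin N)) (β / N)))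
              * (Scoring.kop (wilsonJitterHMC N d L β nstep τ η))^[k + 1]
                (fun y => f y - ∫ z, f z ∂(wilsonMeasure (d := d) (L := L) (fundamentalRep (Fin N)) (β / N))) y
              ∂(wilsonMeasure (d := d) (L := L) (fundamentalRep (Fin N)) (β / N))
          ≤ V * C ^ 2 := by
  obtain ⟨τ₀, hτ₀, h⟩ := wilsonJitterHMC_certificate (N := N) (d := d) (L := L) (Lab := Lab) β
  refine ⟨τ₀, hτ₀, fun nstep τ η _ l₀ hn hl₀ hτl hτl₀ => ?_⟩
  obtain ⟨m, ε', hm, hε0, hε1, hmin⟩ := h nstep τ η l₀ hn hl₀ hτl hτl₀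
  set ρ : ℝ := 1 - ε'.toReal / ((m : ℝ) + 1)
  refine ⟨(4 * (ρ ^ m)⁻¹ / (1 - ρ)) ^ 2, sq_nonneg _, fun f hf C hC => ⟨?_, ?_⟩⟩
  · exact Scoring.greenKubo_nonneg_of_nHit (wilsonJitterHMC_invariant (N := N) (d := d) (L := L) β nstep τ η)
      (GeneralNCMC.minorised_setwise hmin) hε0 hε1 hm hf hC
  · calc _ ≤ (4 * C * (ρ ^ m)⁻¹ / (1 - ρ)) ^ 2 :=
          Scoring.greenKubo_le_of_nHit (wilsonJitterHMC_invariant (N := N) (d := d) (L := L) β nstep τ η)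
            (GeneralNCMC.minorised_setwise hmin) hε0 hε1 hm hf hC
      _ = (4 * (ρ ^ m)⁻¹ / (1 - ρ)) ^ 2 * C ^ 2 := by ring

/-- **THE SAME FOR THE JITTERED ENGINE HMC FOLLOWED BY ANY EXACT STEP** (e.g. the `'hmc' + n_or × 'or'`
composite): every event of the stationary composite chain has `τ_int(1_A) ≤ 1/2 + B/(1 − π(A))`, one `B ≥ 0`
for all events. -/
theorem wilsonJitterHMC_exactStep_tauInt_setACF_le :
    ∃ τ₀ : ℝ, 0 < τ₀ ∧ ∀ (nstep : Lab → ℕ) (τ : Lab → ℝ) (η : Measure Lab) [IsProbabilityMeasure η] (l₀ : Lab),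
      1 ≤ nstep l₀ → η {l₀} ≠ 0 → 0 < τ l₀ → τ l₀ ≤ τ₀ →
      ∀ (P : Kernel (GaugeConfig d L (Matrix.specialUnitaryGroup (Fin N) ℂ)) (GaugeConfig d L (Matrix.specialUnitaryGroup (Fin N) ℂ)))
        [IsMarkovKernel P], Invariant P (wilsonMeasure (d := d) (L := L) (fundamentalRep (Fin N)) (β / N)) →
      ∃ B : ℝ, 0 ≤ B ∧ ∀ A : Set (GaugeConfig d L (Matrix.specialUnitaryGroup (Fin N) ℂ)), MeasurableSet A →
        0 < (wilsonMeasure (d := d) (L := L) (fundamentalRep (Fin N)) (β / N)).real A →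
        (wilsonMeasure (d := d) (L := L) (fundamentalRep (Fin N)) (β / N)).real A < 1 →
        Scoring.tauInt (setACF (P ∘ₖ wilsonJitterHMC N d L β nstep τ η)
            (wilsonMeasure (d := d) (L := L) (fundamentalRep (Fin N)) (β / N)) A) ≤
          1 / 2 + B / (1 - (wilsonMeasure (d := d) (L := L) (fundamentalRep (Fin N)) (β / N)).real A) := by
  obtain ⟨τ₀, hτ₀, h⟩ := wilsonJitterHMC_exactStep_certificate (N := N) (d := d) (L := L) (Lab := Lab) β
  refine ⟨τ₀, hτ₀, fun nstep τ η _ l₀ hn hl₀ hτl hτl₀ P _ hP => ?_⟩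
  obtain ⟨hinv, m, ε', hm, hε0, hε1, hmin⟩ := h nstep τ η l₀ hn hl₀ hτl hτl₀ P hP
  refine ⟨(m : ℝ) / ε'.toReal - 1, doeblinConst_nonneg hm hε0 hε1, fun A hA h0 h1 => ?_⟩
  exact GeneralNCMC.tauInt_setACF_le_of_nHit (GeneralNCMC.minorised_setwise hmin) hε0 hε1 hm hinv hA h0 h1

/-! ## §2 From every start: certified burn-in of time averages -/

/-- **CERTIFIED BURN-IN OF THE ENGINE'S JITTERED `SU(N)` HMC, FROM EVERY START — ONE CONSTANT FOR ALL RUNS.**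
Same `τ₀` and hypotheses; there is `B ≥ 0` such that for EVERY initial law `μ₀`, EVERY measurable `g` with
values in `[0, 1]` and EVERY run length `n ≥ 1`: `|E_{μ₀}[(1/n) Σ_{t<n} g(U_t)] − ∫ g dπ| ≤ B/n`,
`π = wilsonMeasure (β/N)` (the systematic error of a time average started out of equilibrium decays like `1/n`). -/
theorem wilsonJitterHMC_timeAverage_bias_le :
    ∃ τ₀ : ℝ, 0 < τ₀ ∧ ∀ (nstep : Lab → ℕ) (τ : Lab → ℝ) (η : Measure Lab) [IsProbabilityMeasure η] (l₀ : Lab),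
      1 ≤ nstep l₀ → η {l₀} ≠ 0 → 0 < τ l₀ → τ l₀ ≤ τ₀ →
      ∃ B : ℝ, 0 ≤ B ∧ ∀ (μ₀ : Measure (GaugeConfig d L (Matrix.specialUnitaryGroup (Fin N) ℂ))) [IsProbabilityMeasure μ₀]
        (g : GaugeConfig d L (Matrix.specialUnitaryGroup (Fin N) ℂ) → ℝ), Measurable g → (∀ U, 0 ≤ g U) → (∀ U, g U ≤ 1) →
        ∀ n : ℕ, n ≠ 0 →
        |∫ x, (∑ t ∈ Finset.range n, g (x t)) / n
            ∂(Kernel.trajMeasure (X := fun _ : ℕ => GaugeConfig d L (Matrix.specialUnitaryGroup (Fin N) ℂ)) μ₀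
              (fun t : ℕ => (wilsonJitterHMC N d L β nstep τ η).comap
                (fun h : (i : ↥(Finset.Iic t)) → GaugeConfig d L (Matrix.specialUnitaryGroup (Fin N) ℂ) =>
                  h ⟨t, Finset.mem_Iic.2 le_rfl⟩) (measurable_pi_apply _)))
          - ∫ U, g U ∂(wilsonMeasure (d := d) (L := L) (fundamentalRep (Fin N)) (β / N))| ≤ B / n := by
  obtain ⟨τ₀, hτ₀, h⟩ := wilsonJitterHMC_certificate (N := N) (d := d) (L := L) (Lab := Lab) β
  refine ⟨τ₀, hτ₀, fun nstep τ η _ l₀ hn hl₀ hτl hτl₀ => ?_⟩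
  obtain ⟨m, ε', hm, hε0, hε1, hmin⟩ := h nstep τ η l₀ hn hl₀ hτl hτl₀
  have he0 : 0 < ε'.toReal := ENNReal.toReal_pos hε0.ne' (ne_top_of_le_ne_top ENNReal.one_ne_top hε1)
  refine ⟨(m : ℝ) / ε'.toReal, by positivity, fun μ₀ _ g hg h0 h1 n hn => ?_⟩
  calc _ ≤ (m : ℝ) / (ε'.toReal * n) :=
        GeneralNCMC.chain_timeAverage_bias_le_of_nHit (GeneralNCMC.minorised_setwise hmin) hε0 hε1 hm
          (wilsonJitterHMC_invariant (N := N) (d := d) (L := L) β nstep τ η) μ₀ hg h0 h1 hn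
    _ = (m : ℝ) / ε'.toReal / n := by rw [div_div]

/-- **CERTIFIED BURN-IN OF THE JITTERED ENGINE HMC FOLLOWED BY ANY EXACT STEP** (e.g. `'hmc' + n_or × 'or'`):
one `B ≥ 0` with `|E_{μ₀}[(1/n) Σ_{t<n} g(U_t)] − ∫ g dπ| ≤ B/n` for every initial law, every `[0,1]`-valued
measurable `g`, every `n ≥ 1`. -/
theorem wilsonJitterHMC_exactStep_timeAverage_bias_le :
    ∃ τ₀ : ℝ, 0 < τ₀ ∧ ∀ (nstep : Lab → ℕ) (τ : Lab → ℝ) (η : Measure Lab) [IsProbabilityMeasure η] (l₀ : Lab),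
      1 ≤ nstep l₀ → η {l₀} ≠ 0 → 0 < τ l₀ → τ l₀ ≤ τ₀ →
      ∀ (P : Kernel (GaugeConfig d L (Matrix.specialUnitaryGroup (Fin N) ℂ)) (GaugeConfig d L (Matrix.specialUnitaryGroup (Fin N) ℂ)))
        [IsMarkovKernel P], Invariant P (wilsonMeasure (d := d) (L := L) (fundamentalRep (Fin N)) (β / N)) →
      ∃ B : ℝ, 0 ≤ B ∧ ∀ (μ₀ : Measure (GaugeConfig d L (Matrix.specialUnitaryGroup (Fin N) ℂ))) [IsProbabilityMeasure μ₀]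
        (g : GaugeConfig d L (Matrix.specialUnitaryGroup (Fin N) ℂ) → ℝ), Measurable g → (∀ U, 0 ≤ g U) → (∀ U, g U ≤ 1) →
        ∀ n : ℕ, n ≠ 0 →
        |∫ x, (∑ t ∈ Finset.range n, g (x t)) / n
            ∂(Kernel.trajMeasure (X := fun _ : ℕ => GaugeConfig d L (Matrix.specialUnitaryGroup (Fin N) ℂ)) μ₀
              (fun t : ℕ => (P ∘ₖ wilsonJitterHMC N d L β nstep τ η).comap
                (fun h : (i : ↥(Finset.Iic t)) → GaugeConfig d L (Matrix.specialUnitaryGroup (Fin N) ℂ) =>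
                  h ⟨t, Finset.mem_Iic.2 le_rfl⟩) (measurable_pi_apply _)))
          - ∫ U, g U ∂(wilsonMeasure (d := d) (L := L) (fundamentalRep (Fin N)) (β / N))| ≤ B / n := by
  obtain ⟨τ₀, hτ₀, h⟩ := wilsonJitterHMC_exactStep_certificate (N := N) (d := d) (L := L) (Lab := Lab) β
  refine ⟨τ₀, hτ₀, fun nstep τ η _ l₀ hn hl₀ hτl hτl₀ P _ hP => ?_⟩
  obtain ⟨hinv, m, ε', hm, hε0, hε1, hmin⟩ := h nstep τ η l₀ hn hl₀ hτl hτl₀ P hP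
  have he0 : 0 < ε'.toReal := ENNReal.toReal_pos hε0.ne' (ne_top_of_le_ne_top ENNReal.one_ne_top hε1)
  refine ⟨(m : ℝ) / ε'.toReal, by positivity, fun μ₀ _ g hg h0 h1 n hn => ?_⟩
  calc _ ≤ (m : ℝ) / (ε'.toReal * n) :=
        GeneralNCMC.chain_timeAverage_bias_le_of_nHit (GeneralNCMC.minorised_setwise hmin) hε0 hε1 hm
          hinv μ₀ hg h0 h1 hn
    _ = (m : ℝ) / ε'.toReal / n := by rw [div_div]

end FiguresOfMerit

end Summit.Ventures.LatticeQCDFlow.Exactness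

end
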